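import Literature.Topology.FourManifolds.LatticeFormsReflectionGroupAbelianisationTwoGroup
import Literature.Topology.FourManifolds.LatticeFormsNegTwoVectorOrbitsOriented
import HarnessLib

/-!
# "Its order divides `2^N`, where `N` is the number of orbits of `(−2)`-vectors" — Thm. 1.3 from an orbit COUNT, and
# "hence the order of `Õ⁺(L_{2d})^{ab}` divides `4`"
# (Gritsenko–Hulek–Sankaran, *J. Algebra* 322 (2009), Thm. 1.3 and p. 4; GHS, *Doc. Math.* 13 (2008) Prop. 2.4 (ii))

Trunk T-4MAN vocabulary. Row g51-#1 (`LatticeFormsReflectionGroupAbelianisationTwoGroup`) proved GHS Thm. 1.3 with the orbits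
presented by a family `r : Fin N → L` of `(2ε)`-roots meeting every `P`-orbit. This sequel states it with `N` literally "the
number of different `P`-orbits of `(2ε)`-vectors" — the cardinality of the orbit quotient, as the tree counts orbits (rows
g41/g46: `Nat.card (Quot …)`) — by choosing representatives, and then runs the printed application on p. 4: in
`L = B₀ ⊕ ⟨−2d⟩` (`B₀` even unimodular with two orthogonal hyperbolic planes; `L_{2d}^{(m)} = 2U ⊕ mE₈(−1) ⊕ ⟨−2d⟩`, `m = 2` the
K3 lattice `L_{2d}`) the `(−2)`-vectors form `2` or `1` orbits under `Õ⁺(L)` according as `d ≡ 1 (mod 4)` or not (GHS 2008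
Prop. 2.4 (ii), row g46-#9), so — under Kneser's generation `Õ⁺(L) = ⟨σ_a : a² = −2⟩` (Thm. 1.1, a HYPOTHESIS here) — the order
of `Õ⁺(L)^{ab}` divides `4`, and divides `2` when `d ≢ 1 (mod 4)`. Written for lane `lit-hodgefound` (Track 2 foundations;
prover seat `lit-hodgefound-p18`, gen 51, row g51-#3). THEOREMS ONLY — no definition, no named fact, no instance, no notation.

## Sources, verbatim (held `paper:arxiv-0810.1614`)

* p. 3, **Thm. 1.3**: "Then `Õ⁺(L)^{ab}` […] is an abelian `2`-group. Its order divides `2^N` […], where `N` is the number of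
  different `Õ⁺(L)`-orbits […] of `(−2)`-vectors in `L`."
* p. 4: "In the main theorem of [Ko1] it was proved that the order of `Õ(L_{2d})^{ab}` divides `16` or equivalently that the
  order of `Õ⁺(L_{2d})^{ab}` divides `8`. But there are at most two `Õ⁺(L_{2d})`-orbits of `(−2)`-vectors in `L_{2d}` [GHSorth].
  Hence by Theorem 1.3 the order of `Õ⁺(L_{2d})^{ab}` divides `4`. (There are two orbits if and only if `d ≢ 1` mod `4`.)"
  (sic: by GHS 2008 Prop. 2.4 (ii) — "If `d ≡ 1 mod 4` then there is a second orbit" — and the tree's count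
  `natCard_quot_stable_isometryEquiv_isOrientationPreserving_apply_self_eq_neg_two`, there are two orbits iff `d ≡ 1 mod 4`;
  the conclusion "divides `4`" is unaffected.)
* proof of Thm. 1.3: "By Theorem 1.1, any element of `S̃O⁺(L)` is a product of reflections by `(−2)`-vectors, and since `L`
  represents `−2` the same is true for `Õ⁺(L)`" — the generation hypothesis `hK` below (Kneser's Thm. 1.1 is not in the tree
  for non-unimodular `L`).

## Contents (all proved)

* §1 (any symmetric lattice, `ε = ±1`, class `P ∋ 1` closed under composition and inverses) the orbit relation
  "`∃ g ∈ P, g r = s`" on `(2ε)`-roots is an equivalence; a finite orbit count `N ≠ 0` yields representatives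
  `r : Fin N → L` meeting every orbit; **Thm. 1.3 (B) in printed form**: if `P` is generated by the `(2ε)`-reflections then
  `|P^{ab}|` divides `2^{#orbits}` (`natCard_quot_commutators_dvd_two_pow_natCard_quot_orbit`; the roots-free case gives
  `|P^{ab}| = 1`).
* §2 `Õ⁺(L) = {g : ḡ = id on A_L, χ(g) = 1}` is such a class containing the `(−2)`-reflections (any symmetric non-degenerate `L`).
* §3 `L = B₀ ⊕ ⟨−2d⟩`: under `Õ⁺(L) = ⟨σ_a⟩`, `|Õ⁺(L)^{ab}| ∣ 2^{(d ≡ 1 mod 4 ? 2 : 1)} ∣ 4`, and `∣ 2` if `d ≢ 1 (mod 4)`;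
  §4 the models `L_{2d}^{(m)}`.
-/

noncomputable section

open Module
open LinearMap (BilinForm)
open LinearMap.BilinForm
open LinearMap.BilinForm (IsometryEquiv)

namespace Literature.Topology.FourManifolds

universe u

/-! ### §1 Theorem 1.3 from the number of orbits -/

section OrbitCount

variable {W : Type*} [AddCommGroup W] {B : BilinForm ℤ W} {P : B.IsometryEquiv B → Prop}

/-- **"`a ≡ b mod Õ⁺(L)` if there exists `g ∈ Õ⁺(L)` such that `g(a) = b`" is an equivalence relation** on the `(2ε)`-roots,
for a class `P ∋ 1` closed under composition and inverses. [cite: GritsenkoHulekSankaran2009, Thm. 1.3 (proof)] -/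
theorem equivalence_exists_prop_apply_eq {ε : ℤ} (h1 : P (LinearMap.BilinForm.IsometryEquiv.refl B))
    (htrans : ∀ α β : B.IsometryEquiv B, P α → P β → P (α.trans β)) (hsymm : ∀ α : B.IsometryEquiv B, P α → P α.symm) :
    Equivalence fun r s : {r : W // B r r = ε + ε} ↦ ∃ g : B.IsometryEquiv B, P g ∧ g r.1 = s.1 := by
  refine ⟨fun r ↦ ⟨LinearMap.BilinForm.IsometryEquiv.refl B, h1, rfl⟩, fun ⟨g, hg, hgr⟩ ↦ ⟨g.symm, hsymm g hg, ?_⟩,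
    fun ⟨g, hg, hgr⟩ ⟨g', hg', hg's⟩ ↦ ⟨g.trans g', htrans _ _ hg hg', ?_⟩⟩
  · rw [← hgr, LinearMap.BilinForm.IsometryEquiv.symm_apply_apply]
  · rw [LinearMap.BilinForm.IsometryEquiv.trans_apply, hgr, hg's]

/-- **Orbit representatives from an orbit count**: if the `(2ε)`-roots form `N ≠ 0` orbits under `P` (counted as classes of the
orbit relation), there are roots `r_0, …, r_{N−1}` meeting every orbit. [cite: GritsenkoHulekSankaran2009, Thm. 1.3 ("N is the number of different Õ⁺(L)-orbits")] -/
theorem exists_fin_orbitRepresentatives_of_natCard_quot_eq {ε : ℤ} (h1 : P (LinearMap.BilinForm.IsometryEquiv.refl B))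
    (htrans : ∀ α β : B.IsometryEquiv B, P α → P β → P (α.trans β)) (hsymm : ∀ α : B.IsometryEquiv B, P α → P α.symm) {N : ℕ}
    (hN : Nat.card (Quot fun r s : {r : W // B r r = ε + ε} ↦ ∃ g : B.IsometryEquiv B, P g ∧ g r.1 = s.1) = N) (hN0 : N ≠ 0) :
    ∃ r : Fin N → W, (∀ i, B (r i) (r i) = ε + ε) ∧
      ∀ a : W, B a a = ε + ε → ∃ (i : Fin N) (g : B.IsometryEquiv B), P g ∧ g (r i) = a := by
  haveI : Finite (Quot fun r s : {r : W // B r r = ε + ε} ↦ ∃ g : B.IsometryEquiv B, P g ∧ g r.1 = s.1) :=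
    Nat.finite_of_card_ne_zero (by rw [hN]; exact hN0)
  have e : (Quot fun r s : {r : W // B r r = ε + ε} ↦ ∃ g : B.IsometryEquiv B, P g ∧ g r.1 = s.1) ≃ Fin N :=
    (Finite.equivFin _).trans (finCongr hN)
  choose rep hrep using fun q : Quot (fun r s : {r : W // B r r = ε + ε} ↦ ∃ g : B.IsometryEquiv B, P g ∧ g r.1 = s.1) ↦
    Quot.exists_rep q
  refine ⟨fun i ↦ (rep (e.symm i)).1, fun i ↦ (rep (e.symm i)).2, fun a ha ↦ ⟨e (Quot.mk _ ⟨a, ha⟩), ?_⟩⟩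
  have hq : Quot.mk (fun r s : {r : W // B r r = ε + ε} ↦ ∃ g : B.IsometryEquiv B, P g ∧ g r.1 = s.1)
      (rep (e.symm (e (Quot.mk _ ⟨a, ha⟩)))) = Quot.mk _ ⟨a, ha⟩ := by
    rw [Equiv.symm_apply_apply, hrep]
  obtain ⟨g, hg, hga⟩ := (equivalence_exists_prop_apply_eq h1 htrans hsymm).eqvGen_iff.1 (Quot.eq.1 hq)
  exact ⟨g, hg, hga⟩

/-- **Theorem 1.3 (B), printed form with an explicit count: "Its order divides `2^N`, where `N` is the number of different
`P`-orbits of `(2ε)`-vectors"** — `P ∋ 1` a class of isometries closed under composition and inverses, containing the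
`(2ε)`-reflections and generated by them (Kneser's Thm. 1.1 in the printed setting), with `N ≠ 0` orbits of `(2ε)`-roots: the
number of classes of `P` modulo `[P, P]`-words divides `2^N`. [cite: GritsenkoHulekSankaran2009, Thm. 1.3] -/
theorem natCard_quot_commutators_dvd_two_pow_of_natCard_quot_orbit_eq (hB : B.IsSymm) {ε : ℤ} (hε : ε * ε = 1)
    (h1 : P (LinearMap.BilinForm.IsometryEquiv.refl B)) (htrans : ∀ α β : B.IsometryEquiv B, P α → P β → P (α.trans β))
    (hsymm : ∀ α : B.IsometryEquiv B, P α → P α.symm) (hP : ∀ (a : W) (ha : B a a = ε + ε), P (normTwoReflectionEquiv hB a ε ha hε))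
    (hgen : ∀ φ : B.IsometryEquiv B, P φ →
      IsWordIn {ψ : B.IsometryEquiv B | ∃ (a : W) (ha : B a a = ε + ε), ψ = normTwoReflectionEquiv hB a ε ha hε} φ) {N : ℕ}
    (hN : Nat.card (Quot fun r s : {r : W // B r r = ε + ε} ↦ ∃ g : B.IsometryEquiv B, P g ∧ g r.1 = s.1) = N) (hN0 : N ≠ 0) :
    Nat.card (Quot fun φ ρ : {φ : B.IsometryEquiv B // P φ} ↦
      IsWordIn {ψ : B.IsometryEquiv B | ∃ α β : B.IsometryEquiv B, P α ∧ P β ∧ ψ = ((β.symm.trans α.symm).trans β).trans α}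
        (φ.1.trans ρ.1.symm)) ∣ 2 ^ N := by
  obtain ⟨r, hr, horbit⟩ := exists_fin_orbitRepresentatives_of_natCard_quot_eq h1 htrans hsymm hN hN0
  exact natCard_quot_commutators_dvd_two_pow hB hε h1 htrans hsymm hP hgen r hr horbit

/-- **No roots: `P^{ab}` is trivial** — if `L` has no `(2ε)`-vector, a class generated by the `(2ε)`-reflections consists of
the identity alone (pointwise), so it has exactly one class modulo commutator words. [cite: GritsenkoHulekSankaran2009, Thm. 1.3 ("since L represents −2")] -/
theorem natCard_quot_commutators_eq_one_of_forall_apply_self_ne (hB : B.IsSymm) {ε : ℤ} (hε : ε * ε = 1)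
    (h1 : P (LinearMap.BilinForm.IsometryEquiv.refl B))
    (hgen : ∀ φ : B.IsometryEquiv B, P φ →
      IsWordIn {ψ : B.IsometryEquiv B | ∃ (a : W) (ha : B a a = ε + ε), ψ = normTwoReflectionEquiv hB a ε ha hε} φ)
    (hnoroot : ∀ a : W, B a a ≠ ε + ε) :
    Nat.card (Quot fun φ ρ : {φ : B.IsometryEquiv B // P φ} ↦
      IsWordIn {ψ : B.IsometryEquiv B | ∃ α β : B.IsometryEquiv B, P α ∧ P β ∧ ψ = ((β.symm.trans α.symm).trans β).trans α}
        (φ.1.trans ρ.1.symm)) = 1 := by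
  have hid : ∀ φ : B.IsometryEquiv B, P φ → ∀ v, φ v = v := fun φ hφ v ↦ by
    obtain ⟨l, hl, hlφ⟩ := hgen φ hφ
    cases l with
    | nil => exact (hlφ v).symm
    | cons ψ l =>
      exfalso
      rcases hl ψ List.mem_cons_self with ⟨a, ha, -⟩ | ⟨a, ha, -⟩ <;> exact hnoroot a ha
  haveI : Subsingleton (Quot fun φ ρ : {φ : B.IsometryEquiv B // P φ} ↦
      IsWordIn {ψ : B.IsometryEquiv B | ∃ α β : B.IsometryEquiv B, P α ∧ P β ∧ ψ = ((β.symm.trans α.symm).trans β).trans α}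
        (φ.1.trans ρ.1.symm)) :=
    ⟨by
      rintro ⟨φ⟩ ⟨ρ⟩
      refine Quot.sound (IsWordIn.refl.congr fun v ↦ ?_)
      have hρ := hid ρ.1 ρ.2 (ρ.1.symm v)
      rw [LinearMap.BilinForm.IsometryEquiv.apply_symm_apply] at hρ
      change v = ρ.1.symm (φ.1 v)
      rw [hid φ.1 φ.2 v]
      exact hρ⟩
  haveI : Nonempty (Quot fun φ ρ : {φ : B.IsometryEquiv B // P φ} ↦
      IsWordIn {ψ : B.IsometryEquiv B | ∃ α β : B.IsometryEquiv B, P α ∧ P β ∧ ψ = ((β.symm.trans α.symm).trans β).trans α}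
        (φ.1.trans ρ.1.symm)) := ⟨Quot.mk _ ⟨LinearMap.BilinForm.IsometryEquiv.refl B, h1⟩⟩
  exact Nat.card_eq_one_iff_unique.2 ⟨inferInstance, inferInstance⟩

/-- **Theorem 1.3 (B), printed form: `|P^{ab}|` divides `2^N`, `N` = the number of `P`-orbits of `(2ε)`-vectors** (finite
orbit count; for `N = 0` there is no root and `P^{ab}` is trivial). [cite: GritsenkoHulekSankaran2009, Thm. 1.3] -/
theorem natCard_quot_commutators_dvd_two_pow_natCard_quot_orbit (hB : B.IsSymm) {ε : ℤ} (hε : ε * ε = 1)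
    (h1 : P (LinearMap.BilinForm.IsometryEquiv.refl B)) (htrans : ∀ α β : B.IsometryEquiv B, P α → P β → P (α.trans β))
    (hsymm : ∀ α : B.IsometryEquiv B, P α → P α.symm) (hP : ∀ (a : W) (ha : B a a = ε + ε), P (normTwoReflectionEquiv hB a ε ha hε))
    (hgen : ∀ φ : B.IsometryEquiv B, P φ →
      IsWordIn {ψ : B.IsometryEquiv B | ∃ (a : W) (ha : B a a = ε + ε), ψ = normTwoReflectionEquiv hB a ε ha hε} φ)
    [hfin : Finite (Quot fun r s : {r : W // B r r = ε + ε} ↦ ∃ g : B.IsometryEquiv B, P g ∧ g r.1 = s.1)] :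
    Nat.card (Quot fun φ ρ : {φ : B.IsometryEquiv B // P φ} ↦
      IsWordIn {ψ : B.IsometryEquiv B | ∃ α β : B.IsometryEquiv B, P α ∧ P β ∧ ψ = ((β.symm.trans α.symm).trans β).trans α}
        (φ.1.trans ρ.1.symm)) ∣
      2 ^ Nat.card (Quot fun r s : {r : W // B r r = ε + ε} ↦ ∃ g : B.IsometryEquiv B, P g ∧ g r.1 = s.1) := by
  by_cases h0 : Nat.card (Quot fun r s : {r : W // B r r = ε + ε} ↦ ∃ g : B.IsometryEquiv B, P g ∧ g r.1 = s.1) = 0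
  · have hempty : IsEmpty (Quot fun r s : {r : W // B r r = ε + ε} ↦ ∃ g : B.IsometryEquiv B, P g ∧ g r.1 = s.1) :=
      (Nat.card_eq_zero.1 h0).resolve_right (not_infinite_iff_finite.2 hfin)
    rw [h0, pow_zero, Nat.dvd_one]
    exact natCard_quot_commutators_eq_one_of_forall_apply_self_ne hB hε h1 hgen fun a ha ↦ hempty.false (Quot.mk _ ⟨a, ha⟩)
  · exact natCard_quot_commutators_dvd_two_pow_of_natCard_quot_orbit_eq hB hε h1 htrans hsymm hP hgen rfl h0

/-- Theorem 1.3 (B), inequality form: `|P^{ab}| ≤ 2^{#orbits}`. [cite: GritsenkoHulekSankaran2009, Thm. 1.3] -/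
theorem natCard_quot_commutators_le_two_pow_natCard_quot_orbit (hB : B.IsSymm) {ε : ℤ} (hε : ε * ε = 1)
    (h1 : P (LinearMap.BilinForm.IsometryEquiv.refl B)) (htrans : ∀ α β : B.IsometryEquiv B, P α → P β → P (α.trans β))
    (hsymm : ∀ α : B.IsometryEquiv B, P α → P α.symm) (hP : ∀ (a : W) (ha : B a a = ε + ε), P (normTwoReflectionEquiv hB a ε ha hε))
    (hgen : ∀ φ : B.IsometryEquiv B, P φ →
      IsWordIn {ψ : B.IsometryEquiv B | ∃ (a : W) (ha : B a a = ε + ε), ψ = normTwoReflectionEquiv hB a ε ha hε} φ)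
    [Finite (Quot fun r s : {r : W // B r r = ε + ε} ↦ ∃ g : B.IsometryEquiv B, P g ∧ g r.1 = s.1)] :
    Nat.card (Quot fun φ ρ : {φ : B.IsometryEquiv B // P φ} ↦
      IsWordIn {ψ : B.IsometryEquiv B | ∃ α β : B.IsometryEquiv B, P α ∧ P β ∧ ψ = ((β.symm.trans α.symm).trans β).trans α}
        (φ.1.trans ρ.1.symm)) ≤
      2 ^ Nat.card (Quot fun r s : {r : W // B r r = ε + ε} ↦ ∃ g : B.IsometryEquiv B, P g ∧ g r.1 = s.1) :=
  Nat.le_of_dvd (by positivity) (natCard_quot_commutators_dvd_two_pow_natCard_quot_orbit hB hε h1 htrans hsymm hP hgen)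

end OrbitCount

/-! ### §2 The class `Õ⁺(L) = {g : ḡ = id on A_L} ∩ O⁺(L)` -/

section StableOrientationPreserving

variable {M : Type u} [AddCommGroup M] [Module.Finite ℤ M] [Module.Free ℤ M] (B : BilinForm ℤ M)

/-- `1 ∈ Õ⁺(L)`. [cite: GritsenkoHulekSankaran2009, §1 ("Õ⁺(L) = Õ(L) ∩ O⁺(L)")] -/
theorem stableOrientationPreserving_refl :
    (LinearMap.BilinForm.IsometryEquiv.refl B).discriminantGroupCongr = LinearEquiv.refl ℤ B.discriminantGroup ∧
      (LinearMap.BilinForm.IsometryEquiv.refl B).IsOrientationPreserving :=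
  ⟨LinearMap.BilinForm.IsometryEquiv.discriminantGroupCongr_refl, LinearMap.BilinForm.IsometryEquiv.IsOrientationPreserving.refl⟩

/-- `Õ⁺(L)` is closed under composition (`B` symmetric non-degenerate). [cite: GritsenkoHulekSankaran2009, §1 ("Õ⁺(L) = Õ(L) ∩ O⁺(L)")] -/
theorem stableOrientationPreserving_trans (hB : B.IsSymm) (hnd : B.Nondegenerate) (α β : B.IsometryEquiv B)
    (hα : α.discriminantGroupCongr = LinearEquiv.refl ℤ B.discriminantGroup ∧ α.IsOrientationPreserving)
    (hβ : β.discriminantGroupCongr = LinearEquiv.refl ℤ B.discriminantGroup ∧ β.IsOrientationPreserving) :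
    (α.trans β).discriminantGroupCongr = LinearEquiv.refl ℤ B.discriminantGroup ∧ (α.trans β).IsOrientationPreserving := by
  refine ⟨?_, (LinearMap.BilinForm.IsometryEquiv.isOrientationPreserving_trans_iff hB hnd α β).2 (iff_of_true hβ.2 hα.2)⟩
  rw [LinearMap.BilinForm.IsometryEquiv.discriminantGroupCongr_trans, hα.1, hβ.1, LinearEquiv.trans_refl]

/-- `Õ⁺(L)` is closed under inverses (`B` symmetric non-degenerate). [cite: GritsenkoHulekSankaran2009, §1 ("Õ⁺(L) = Õ(L) ∩ O⁺(L)")] -/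
theorem stableOrientationPreserving_symm (hB : B.IsSymm) (hnd : B.Nondegenerate) (α : B.IsometryEquiv B)
    (hα : α.discriminantGroupCongr = LinearEquiv.refl ℤ B.discriminantGroup ∧ α.IsOrientationPreserving) :
    α.symm.discriminantGroupCongr = LinearEquiv.refl ℤ B.discriminantGroup ∧ α.symm.IsOrientationPreserving := by
  refine ⟨?_, (LinearMap.BilinForm.IsometryEquiv.isOrientationPreserving_symm_iff hB hnd α).2 hα.2⟩
  rw [LinearMap.BilinForm.IsometryEquiv.discriminantGroupCongr_symm, hα.1, LinearEquiv.refl_symm]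

/-- **"The reflection `σ_a` determined by a `(−2)`-vector `a` belongs to `Õ⁺(L)`"** (`B` symmetric non-degenerate).
[cite: GritsenkoHulekSankaran2009, §1 ("σ_a […] belongs to Õ⁺(L)")] [cite: GritsenkoHulekSankaran2007HM, §4 (proof of Lemma 4.2)] -/
theorem stableOrientationPreserving_negTwoReflection (hB : B.IsSymm) (hnd : B.Nondegenerate) (a : M) (ha : B a a = -1 + -1) :
    (normTwoReflectionEquiv hB a (-1) ha (by norm_num)).discriminantGroupCongr = LinearEquiv.refl ℤ B.discriminantGroup ∧
      (normTwoReflectionEquiv hB a (-1) ha (by norm_num)).IsOrientationPreserving :=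
  ⟨discriminantGroupCongr_normTwoReflectionEquiv B hB a (Or.inr rfl) ha _,
    (isOrientationPreserving_normTwoReflectionEquiv_iff _ hB hnd a (-1) ha _).2 rfl⟩

/-- **Thm. 1.3 (B) for `Õ⁺(L)` under Kneser's generation `Õ⁺(L) = ⟨σ_a : a² = −2⟩`**, for any symmetric non-degenerate lattice
with finitely many `Õ⁺(L)`-orbits of `(−2)`-vectors: `|Õ⁺(L)^{ab}|` divides `2^N`, `N` the number of orbits.
[cite: GritsenkoHulekSankaran2009, Thm. 1.3] -/
theorem natCard_quot_stableOrientationPreserving_commutators_dvd_two_pow (hB : B.IsSymm) (hnd : B.Nondegenerate)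
    (hK : ∀ φ : B.IsometryEquiv B, φ.discriminantGroupCongr = LinearEquiv.refl ℤ B.discriminantGroup ∧ φ.IsOrientationPreserving →
      IsWordIn {ψ : B.IsometryEquiv B | ∃ (a : M) (ha : B a a = -1 + -1), ψ = normTwoReflectionEquiv hB a (-1) ha (by norm_num)} φ)
    [Finite (Quot fun r s : {r : M // B r r = -1 + -1} ↦ ∃ g : B.IsometryEquiv B,
      (g.discriminantGroupCongr = LinearEquiv.refl ℤ B.discriminantGroup ∧ g.IsOrientationPreserving) ∧ g r.1 = s.1)] :
    Nat.card (Quot fun φ ρ : {φ : B.IsometryEquiv B // φ.discriminantGroupCongr = LinearEquiv.refl ℤ B.discriminantGroup ∧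
        φ.IsOrientationPreserving} ↦
      IsWordIn {ψ : B.IsometryEquiv B | ∃ α β : B.IsometryEquiv B,
        (α.discriminantGroupCongr = LinearEquiv.refl ℤ B.discriminantGroup ∧ α.IsOrientationPreserving) ∧
        (β.discriminantGroupCongr = LinearEquiv.refl ℤ B.discriminantGroup ∧ β.IsOrientationPreserving) ∧
        ψ = ((β.symm.trans α.symm).trans β).trans α} (φ.1.trans ρ.1.symm)) ∣
      2 ^ Nat.card (Quot fun r s : {r : M // B r r = -1 + -1} ↦ ∃ g : B.IsometryEquiv B,
        (g.discriminantGroupCongr = LinearEquiv.refl ℤ B.discriminantGroup ∧ g.IsOrientationPreserving) ∧ g r.1 = s.1) :=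
  natCard_quot_commutators_dvd_two_pow_natCard_quot_orbit
    (P := fun g : B.IsometryEquiv B ↦ g.discriminantGroupCongr = LinearEquiv.refl ℤ B.discriminantGroup ∧ g.IsOrientationPreserving)
    hB (ε := -1) (by norm_num) (stableOrientationPreserving_refl B) (stableOrientationPreserving_trans B hB hnd)
    (stableOrientationPreserving_symm B hB hnd) (fun a ha ↦ stableOrientationPreserving_negTwoReflection B hB hnd a ha) hK

end StableOrientationPreserving

/-! ### §3 `L = B₀ ⊕ ⟨−2d⟩`: "Hence by Theorem 1.3 the order of `Õ⁺(L_{2d})^{ab}` divides `4`" -/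

section Abstract

variable {M : Type u} [AddCommGroup M] [Module.Finite ℤ M] [Module.Free ℤ M] {B₀ : BilinForm ℤ M} (d : ℕ)

/-- The tree's count of `Õ⁺(L)`-orbits of `(−2)`-vectors in `L = B₀ ⊕ ⟨−2d⟩` (GHS 2008 Prop. 2.4 (ii), row g46-#9), restated on
the root type `r² = −1 + −1` and the class `Õ⁺(L)` of §2: `2` orbits if `d ≡ 1 (mod 4)`, else `1`.
[cite: GritsenkoHulekSankaran2008Proportionality, Prop. 2.4 (ii)] -/
theorem natCard_quot_stableOrientationPreserving_orbit_apply_self_eq_neg_one_add_neg_one (hu : B₀.IsUnimodular)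
    (he : B₀.IsEven) (hd : 0 < d) {x y x₁ y₁ : M} (h : TwoHyperbolicPairs B₀ x y x₁ y₁) :
    Nat.card (Quot fun r s : {r : M × ℤ // B₀.prod ((-(2 * d : ℤ)) • LinearMap.mul ℤ ℤ) r r = -1 + -1} ↦
      ∃ g : (B₀.prod ((-(2 * d : ℤ)) • LinearMap.mul ℤ ℤ)).IsometryEquiv (B₀.prod ((-(2 * d : ℤ)) • LinearMap.mul ℤ ℤ)),
        (g.discriminantGroupCongr = LinearEquiv.refl ℤ _ ∧ g.IsOrientationPreserving) ∧ g r.1 = s.1) =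
      if d % 4 = 1 then 2 else 1 := by
  refine Eq.trans (Nat.card_congr (Quot.congr (Equiv.subtypeEquivRight fun r ↦ ⟨fun hr ↦ hr.trans (by norm_num),
    fun hr ↦ hr.trans (by norm_num)⟩) fun r s ↦ ?_))
    (natCard_quot_stable_isometryEquiv_isOrientationPreserving_apply_self_eq_neg_two d hu he hd h)
  simp only [Equiv.subtypeEquivRight_apply_coe, and_assoc]

/-- **"Hence by Theorem 1.3 the order of `Õ⁺(L_{2d})^{ab}` divides `4`"**, abstract form: for `L = B₀ ⊕ ⟨−2d⟩` (`B₀` symmetric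
even unimodular with two orthogonal hyperbolic planes, `d ≥ 1`), under Kneser's generation `Õ⁺(L) = ⟨σ_a : a² = −2⟩`
(Thm. 1.1), the order of `Õ⁺(L)^{ab}` divides `2^N` with `N = 2` if `d ≡ 1 (mod 4)` and `N = 1` otherwise — the number of
`Õ⁺(L)`-orbits of `(−2)`-vectors (Prop. 2.4 (ii)). [cite: GritsenkoHulekSankaran2009, Thm. 1.3 and p. 4 ("Hence by Theorem 1.3 the order of Õ⁺(L_{2d})^{ab} divides 4")] [cite: GritsenkoHulekSankaran2008Proportionality, Prop. 2.4 (ii)] -/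
theorem natCard_quot_stableOrientationPreserving_commutators_dvd_two_pow_ite (hu : B₀.IsUnimodular) (he : B₀.IsEven)
    (hd : 0 < d) {x y x₁ y₁ : M} (h : TwoHyperbolicPairs B₀ x y x₁ y₁)
    (hK : ∀ φ : (B₀.prod ((-(2 * d : ℤ)) • LinearMap.mul ℤ ℤ)).IsometryEquiv (B₀.prod ((-(2 * d : ℤ)) • LinearMap.mul ℤ ℤ)),
      φ.discriminantGroupCongr = LinearEquiv.refl ℤ _ ∧ φ.IsOrientationPreserving →
      IsWordIn {ψ | ∃ (a : M × ℤ) (ha : B₀.prod ((-(2 * d : ℤ)) • LinearMap.mul ℤ ℤ) a a = -1 + -1),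
        ψ = normTwoReflectionEquiv (h.isSymm.prod (isSymm_smul_mul _)) a (-1) ha (by norm_num)} φ) :
    Nat.card (Quot fun φ ρ : {φ : (B₀.prod ((-(2 * d : ℤ)) • LinearMap.mul ℤ ℤ)).IsometryEquiv
        (B₀.prod ((-(2 * d : ℤ)) • LinearMap.mul ℤ ℤ)) // φ.discriminantGroupCongr = LinearEquiv.refl ℤ _ ∧ φ.IsOrientationPreserving} ↦
      IsWordIn {ψ | ∃ α β : (B₀.prod ((-(2 * d : ℤ)) • LinearMap.mul ℤ ℤ)).IsometryEquiv (B₀.prod ((-(2 * d : ℤ)) • LinearMap.mul ℤ ℤ)),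
        (α.discriminantGroupCongr = LinearEquiv.refl ℤ _ ∧ α.IsOrientationPreserving) ∧
        (β.discriminantGroupCongr = LinearEquiv.refl ℤ _ ∧ β.IsOrientationPreserving) ∧
        ψ = ((β.symm.trans α.symm).trans β).trans α} (φ.1.trans ρ.1.symm)) ∣ 2 ^ (if d % 4 = 1 then 2 else 1) :=
  natCard_quot_commutators_dvd_two_pow_of_natCard_quot_orbit_eq
    (P := fun g : (B₀.prod ((-(2 * d : ℤ)) • LinearMap.mul ℤ ℤ)).IsometryEquiv (B₀.prod ((-(2 * d : ℤ)) • LinearMap.mul ℤ ℤ)) ↦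
      g.discriminantGroupCongr = LinearEquiv.refl ℤ _ ∧ g.IsOrientationPreserving)
    (h.isSymm.prod (isSymm_smul_mul _)) (ε := -1) (by norm_num) (stableOrientationPreserving_refl _)
    (stableOrientationPreserving_trans _ (h.isSymm.prod (isSymm_smul_mul _)) (nondegenerate_prod_neg_twoMul_smul_mul B₀ d hu hd))
    (stableOrientationPreserving_symm _ (h.isSymm.prod (isSymm_smul_mul _)) (nondegenerate_prod_neg_twoMul_smul_mul B₀ d hu hd))
    (fun a ha ↦ stableOrientationPreserving_negTwoReflection _ (h.isSymm.prod (isSymm_smul_mul _))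
      (nondegenerate_prod_neg_twoMul_smul_mul B₀ d hu hd) a ha)
    hK (natCard_quot_stableOrientationPreserving_orbit_apply_self_eq_neg_one_add_neg_one d hu he hd h) (by split_ifs <;> norm_num)

/-- **"Hence by Theorem 1.3 the order of `Õ⁺(L_{2d})^{ab}` divides `4`"** (abstract `L = B₀ ⊕ ⟨−2d⟩`, Kneser generation as
hypothesis). [cite: GritsenkoHulekSankaran2009, Thm. 1.3 and p. 4] [cite: GritsenkoHulekSankaran2008Proportionality, Prop. 2.4 (ii)] -/
theorem natCard_quot_stableOrientationPreserving_commutators_dvd_four (hu : B₀.IsUnimodular) (he : B₀.IsEven)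
    (hd : 0 < d) {x y x₁ y₁ : M} (h : TwoHyperbolicPairs B₀ x y x₁ y₁)
    (hK : ∀ φ : (B₀.prod ((-(2 * d : ℤ)) • LinearMap.mul ℤ ℤ)).IsometryEquiv (B₀.prod ((-(2 * d : ℤ)) • LinearMap.mul ℤ ℤ)),
      φ.discriminantGroupCongr = LinearEquiv.refl ℤ _ ∧ φ.IsOrientationPreserving →
      IsWordIn {ψ | ∃ (a : M × ℤ) (ha : B₀.prod ((-(2 * d : ℤ)) • LinearMap.mul ℤ ℤ) a a = -1 + -1),
        ψ = normTwoReflectionEquiv (h.isSymm.prod (isSymm_smul_mul _)) a (-1) ha (by norm_num)} φ) :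
    Nat.card (Quot fun φ ρ : {φ : (B₀.prod ((-(2 * d : ℤ)) • LinearMap.mul ℤ ℤ)).IsometryEquiv
        (B₀.prod ((-(2 * d : ℤ)) • LinearMap.mul ℤ ℤ)) // φ.discriminantGroupCongr = LinearEquiv.refl ℤ _ ∧ φ.IsOrientationPreserving} ↦
      IsWordIn {ψ | ∃ α β : (B₀.prod ((-(2 * d : ℤ)) • LinearMap.mul ℤ ℤ)).IsometryEquiv (B₀.prod ((-(2 * d : ℤ)) • LinearMap.mul ℤ ℤ)),
        (α.discriminantGroupCongr = LinearEquiv.refl ℤ _ ∧ α.IsOrientationPreserving) ∧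
        (β.discriminantGroupCongr = LinearEquiv.refl ℤ _ ∧ β.IsOrientationPreserving) ∧
        ψ = ((β.symm.trans α.symm).trans β).trans α} (φ.1.trans ρ.1.symm)) ∣ 4 := by
  refine (natCard_quot_stableOrientationPreserving_commutators_dvd_two_pow_ite d hu he hd h hK).trans ?_
  split_ifs <;> norm_num

/-- **`d ≢ 1 (mod 4)`: one orbit, so the order of `Õ⁺(L)^{ab}` divides `2`** (abstract `L = B₀ ⊕ ⟨−2d⟩`, Kneser generation as
hypothesis). [cite: GritsenkoHulekSankaran2009, Thm. 1.3 and p. 4] [cite: GritsenkoHulekSankaran2008Proportionality, Prop. 2.4 (ii)] -/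
theorem natCard_quot_stableOrientationPreserving_commutators_dvd_two_of_mod_four_ne_one (hu : B₀.IsUnimodular)
    (he : B₀.IsEven) (hd : 0 < d) (hd4 : d % 4 ≠ 1) {x y x₁ y₁ : M} (h : TwoHyperbolicPairs B₀ x y x₁ y₁)
    (hK : ∀ φ : (B₀.prod ((-(2 * d : ℤ)) • LinearMap.mul ℤ ℤ)).IsometryEquiv (B₀.prod ((-(2 * d : ℤ)) • LinearMap.mul ℤ ℤ)),
      φ.discriminantGroupCongr = LinearEquiv.refl ℤ _ ∧ φ.IsOrientationPreserving →
      IsWordIn {ψ | ∃ (a : M × ℤ) (ha : B₀.prod ((-(2 * d : ℤ)) • LinearMap.mul ℤ ℤ) a a = -1 + -1),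
        ψ = normTwoReflectionEquiv (h.isSymm.prod (isSymm_smul_mul _)) a (-1) ha (by norm_num)} φ) :
    Nat.card (Quot fun φ ρ : {φ : (B₀.prod ((-(2 * d : ℤ)) • LinearMap.mul ℤ ℤ)).IsometryEquiv
        (B₀.prod ((-(2 * d : ℤ)) • LinearMap.mul ℤ ℤ)) // φ.discriminantGroupCongr = LinearEquiv.refl ℤ _ ∧ φ.IsOrientationPreserving} ↦
      IsWordIn {ψ | ∃ α β : (B₀.prod ((-(2 * d : ℤ)) • LinearMap.mul ℤ ℤ)).IsometryEquiv (B₀.prod ((-(2 * d : ℤ)) • LinearMap.mul ℤ ℤ)),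
        (α.discriminantGroupCongr = LinearEquiv.refl ℤ _ ∧ α.IsOrientationPreserving) ∧
        (β.discriminantGroupCongr = LinearEquiv.refl ℤ _ ∧ β.IsOrientationPreserving) ∧
        ψ = ((β.symm.trans α.symm).trans β).trans α} (φ.1.trans ρ.1.symm)) ∣ 2 := by
  have h' := natCard_quot_stableOrientationPreserving_commutators_dvd_two_pow_ite d hu he hd h hK
  rwa [if_neg hd4, pow_one] at h'

end Abstract

/-! ### §4 The models `L_{2d}^{(m)} = (E₈(−1)^{⊕m} ⊕ U^{⊕2}) ⊕ ℤ(−2d)` (`m = 2`: the K3 lattice `L_{2d}`) -/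

section Model

variable (m d : ℕ)

/-- **"Hence by Theorem 1.3 the order of `Õ⁺(L_{2d})^{ab}` divides `4`"** for the models `L_{2d}^{(m)} = mE₈(−1) ⊕ 2U ⊕ ⟨−2d⟩`
(`m = 2`: the polarised-K3 lattice `L_{2d}`), under Kneser's generation `Õ⁺ = ⟨σ_a : a² = −2⟩` (Thm. 1.1; Kondō [Ko1] had "divides
`8`"; GHS Thm. 1.7 later gives order exactly `2`). [cite: GritsenkoHulekSankaran2009, Thm. 1.3 and p. 4] [cite: GritsenkoHulekSankaran2008Proportionality, Prop. 2.4 (ii)] -/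
theorem natCard_quot_stableOrientationPreserving_latticeL2dm_commutators_dvd_four (hd : 0 < d)
    (hK : ∀ φ : ((((LinearMap.BilinForm.pi fun _ : Fin m ↦ -e8Form).prod (hyperbolicSum 2)).prod
        ((-(2 * d : ℤ)) • LinearMap.mul ℤ ℤ))).IsometryEquiv
        ((((LinearMap.BilinForm.pi fun _ : Fin m ↦ -e8Form).prod (hyperbolicSum 2)).prod ((-(2 * d : ℤ)) • LinearMap.mul ℤ ℤ))),
      φ.discriminantGroupCongr = LinearEquiv.refl ℤ _ ∧ φ.IsOrientationPreserving →
      IsWordIn {ψ | ∃ (a : ((Fin m → Fin 8 → ℤ) × ((Fin 2 → ℤ) × (Fin 2 → ℤ))) × ℤ)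
        (ha : (((LinearMap.BilinForm.pi fun _ : Fin m ↦ -e8Form).prod (hyperbolicSum 2)).prod
          ((-(2 * d : ℤ)) • LinearMap.mul ℤ ℤ)) a a = -1 + -1),
        ψ = normTwoReflectionEquiv ((twoHyperbolicPairs_pi_neg_e8Form_prod_hyperbolicSum_two m).isSymm.prod (isSymm_smul_mul _))
          a (-1) ha (by norm_num)} φ) :
    Nat.card (Quot fun φ ρ : {φ : ((((LinearMap.BilinForm.pi fun _ : Fin m ↦ -e8Form).prod (hyperbolicSum 2)).prod
        ((-(2 * d : ℤ)) • LinearMap.mul ℤ ℤ))).IsometryEquiv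
        ((((LinearMap.BilinForm.pi fun _ : Fin m ↦ -e8Form).prod (hyperbolicSum 2)).prod ((-(2 * d : ℤ)) • LinearMap.mul ℤ ℤ))) //
        φ.discriminantGroupCongr = LinearEquiv.refl ℤ _ ∧ φ.IsOrientationPreserving} ↦
      IsWordIn {ψ | ∃ α β : ((((LinearMap.BilinForm.pi fun _ : Fin m ↦ -e8Form).prod (hyperbolicSum 2)).prod
          ((-(2 * d : ℤ)) • LinearMap.mul ℤ ℤ))).IsometryEquiv
          ((((LinearMap.BilinForm.pi fun _ : Fin m ↦ -e8Form).prod (hyperbolicSum 2)).prod ((-(2 * d : ℤ)) • LinearMap.mul ℤ ℤ))),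
        (α.discriminantGroupCongr = LinearEquiv.refl ℤ _ ∧ α.IsOrientationPreserving) ∧
        (β.discriminantGroupCongr = LinearEquiv.refl ℤ _ ∧ β.IsOrientationPreserving) ∧
        ψ = ((β.symm.trans α.symm).trans β).trans α} (φ.1.trans ρ.1.symm)) ∣ 4 := by
  obtain ⟨-, heB, huB⟩ := isSymm_isEven_isUnimodular_pi_neg_e8Form_prod_hyperbolicSum_two m
  exact natCard_quot_stableOrientationPreserving_commutators_dvd_four d huB heB hd
    (twoHyperbolicPairs_pi_neg_e8Form_prod_hyperbolicSum_two m) hK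

end Model

end Literature.Topology.FourManifolds

end
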